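import Literature.AlgebraicGeometry.HodgeTheory.SignSymmetricTransvectionMonodromyOneSeed
import HarnessLib

/-!
# Orthogonal connectedness of `R₊` from LINKS ONLY (any number of fixed orbits, or none)

Family `hodge`, layer `Literature/AlgebraicGeometry/HodgeTheory`; sequel of `SignSymmetricTransvectionMonodromy` §4 (theorems only).
Written by the prover seat `hodge-nonav-19716-p2` (g9, cell `hodge-nonav`) as brick 3a of «W-ELIM» for crux K1-B
`VeryGeneralSignCommutatorsInHg` (`Summits/HodgeConjecture/HodgeConjecture/Theses/SignSymmetricPowers.lean`, stmt-HodgeConjecture-19716).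

`orthogonallyConnected_of_signSymmetric_orbits` (Corollary T′) assumes that the fixed centres of parity `+` form ONE `Γ`-orbit up to
sign and that ONE of them is linked to a paired centre.  With fixed centres of UNKNOWN sign (W-ELIM) the `+` side may contain
SEVERAL fixed orbits (the Π- and the L-orbit may land on the same side) or NONE (the other side).  The variant below covers all
cases at once: it asks only that the paired centres `D ≠ ∅` form one `Γ`-orbit up to sign and up to `σ` and that EVERY fixed
centre of parity `+` be linked to some paired centre (`⟨r, δ⟩ ≠ 0`; for an orbit this follows from one link).

* `orthogonallyConnected_of_links` — then `R₊ = {r ∈ T | σr = r} ∪ {δ + σδ | δ ∈ D}` is orthogonally connected.  Proof (Deligne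
  (4.4.4^α)): an orthogonal splitting `R₊ = A ⊔ A'` is preserved by every generator (`U_r`, `r ∈ V₋`, acts trivially on `V₊`;
  `U_r`, `r ∈ R₊`, and the pairs `U_δU_{σδ} : ρ ↦ ρ + c⟨ρ, δ⟩(δ + σδ)` move a vector only along a vector ADJACENT to it), hence by
  `Γ`; `ρ` and `−ρ` lie on the same side (a common neighbour exists by the span hypothesis and non-degeneracy); so the pair
  orbit lies on one side and every fixed centre is dragged to it by its link.
* `orthogonallyConnected_of_links_neg` — the `−` side (apply to `−σ`).

References: [Deligne1980] P. Deligne, *La conjecture de Weil : II*, §4.4 (4.4.4^α) p. 228.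
-/

noncomputable section

namespace Literature.AlgebraicGeometry.HodgeTheory

open Literature.AlgebraicGeometry.Motives Literature.LinearAlgebra.Alternating

universe u v

variable {K : Type u} [Field K] {V : Type v} [AddCommGroup V] [Module K V] {B : LinearMap.BilinForm K V}

/-- **Corollary T′ from links only.**  See the module docstring. [cite: Deligne1980, §4.4 (4.4.4^α) p. 228] -/
theorem orthogonallyConnected_of_links (hB : B.IsAlt) (hBn : B.Nondegenerate)
    (h2 : (2 : K) ≠ 0) {σ : V →ₗ[K] V} (hσ : σ ^ 2 = 1) (hσB : ∀ x y, B (σ x) (σ y) = B x y)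
    {Γ : Subgroup (V ≃ₗ[K] V)} {E : Set (V ≃ₗ[K] V)} (hΓE : Γ = Subgroup.closure E)
    (hΓσ : ∀ g ∈ Γ, ∀ x, g (σ x) = σ (g x)) {T D : Set V}
    (hE : ∀ e ∈ E, (∃ r ∈ T, ∃ c : K, (e : V →ₗ[K] V) = oneParamTransvection B r c) ∨
      (∃ δ ∈ D, ∃ c : K, (e : V →ₗ[K] V) = oneParamTransvection B δ c * oneParamTransvection B (σ δ) c))
    (hTσ : ∀ r ∈ T, σ r = r ∨ σ r = -r) (hTst : ∀ g ∈ Γ, ∀ r ∈ T, g r ∈ T)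
    (hT0 : ∀ r ∈ T, σ r = r → r ≠ 0)
    (hDσ0 : ∀ δ ∈ D, B δ (σ δ) = 0) (hDst : ∀ g ∈ Γ, ∀ δ ∈ D, g δ ∈ D) (hD0 : ∀ δ ∈ D, δ + σ δ ≠ 0)
    (hDne : D.Nonempty)
    (htransD : ∀ δ ∈ D, ∀ δ' ∈ D, ∃ g ∈ Γ, g δ = δ' ∨ g δ = -δ' ∨ g δ = σ δ' ∨ g δ = -(σ δ'))
    (hlink : ∀ r ∈ T, σ r = r → ∃ δ ∈ D, B r δ ≠ 0)
    (hspan : Submodule.span K ({r ∈ T | σ r = r} ∪ (fun δ => δ + σ δ) '' D) = Module.End.eigenspace σ 1) :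
    ∀ A ⊆ {r ∈ T | σ r = r} ∪ (fun δ => δ + σ δ) '' D, A.Nonempty →
      A ≠ {r ∈ T | σ r = r} ∪ (fun δ => δ + σ δ) '' D →
      ∃ r ∈ A, ∃ ρ ∈ {r ∈ T | σ r = r} ∪ (fun δ => δ + σ δ) '' D, ρ ∉ A ∧ B r ρ ≠ 0 := by
  set R := {r ∈ T | σ r = r} ∪ (fun δ => δ + σ δ) '' D with hR
  have hσσ : ∀ x, σ (σ x) = x := fun x => by rw [← Module.End.mul_apply, ← pow_two, hσ, Module.End.one_apply]
  have hRfix : ∀ ρ ∈ R, σ ρ = ρ := by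
    rintro ρ (⟨-, hρ⟩ | ⟨δ, -, rfl⟩)
    · exact hρ
    · rw [map_add, hσσ, add_comm]
  have hR0 : ∀ ρ ∈ R, ρ ≠ 0 := by
    rintro ρ (⟨hρT, hρ⟩ | ⟨δ, hδ, rfl⟩)
    · exact hT0 ρ hρT hρ
    · exact hD0 δ hδ
  -- `R` is `Γ`-stable
  have hRst : ∀ g ∈ Γ, ∀ ρ ∈ R, g ρ ∈ R := by
    rintro g hg ρ (⟨hρT, hρ⟩ | ⟨δ, hδ, rfl⟩)
    · exact Or.inl ⟨hTst g hg ρ hρT, by rw [← hΓσ g hg, hρ]⟩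
    · exact Or.inr ⟨g δ, hDst g hg δ hδ, by rw [map_add, hΓσ g hg]⟩
  -- pairings with `σ`-fixed vectors
  have hBσ : ∀ a δ : V, σ a = a → B a (σ δ) = B a δ := fun a δ ha => by rw [← hσB a (σ δ), ha, hσσ]
  have hB0 : ∀ a r : V, σ a = a → σ r = -r → B a r = 0 := by
    intro a r ha hr
    have h : B a r = -B a r := by
      conv_lhs => rw [← hσB a r, ha, hr, map_neg]
    have h' : (2 : K) * B a r = 0 := by rw [two_mul]; nth_rw 2 [h]; exact add_neg_cancel _
    exact (mul_eq_zero.1 h').resolve_left h2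
  intro A hAR hAne hAR'
  by_contra hcon
  push Not at hcon
  -- adjacency forces the same side
  have hadj : ∀ x ∈ R, ∀ y ∈ R, B x y ≠ 0 → (x ∈ A ↔ y ∈ A) := by
    intro x hx y hy hxy
    constructor
    · intro hxA
      by_contra hyA
      exact hxy (hcon x hxA y hy hyA)
    · intro hyA
      by_contra hxA
      have h := hcon y hyA x hx hxA
      rw [← hB.neg_eq, neg_eq_zero] at h
      exact hxy h
  -- every generator, hence every element of `Γ`, preserves the side of each `ρ ∈ R`
  have hgen : ∀ e ∈ E, ∀ ρ ∈ R, (ρ ∈ A ↔ e ρ ∈ A) := by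
    intro e he ρ hρ
    have heΓ : e ∈ Γ := by rw [hΓE]; exact Subgroup.subset_closure he
    have heρR : e ρ ∈ R := hRst e heΓ ρ hρ
    rcases hE e he with ⟨r, hr, c, hec⟩ | ⟨δ, hδ, c, hec⟩
    · have heρ : e ρ = ρ + (c * B ρ r) • r := by
        rw [← LinearEquiv.coe_coe, hec, oneParamTransvection_apply]
      rcases hTσ r hr with hrσ | hrσ
      · by_cases hρr : B ρ r = 0
        · rw [heρ, hρr, mul_zero, zero_smul, add_zero]
        · have hrR : r ∈ R := Or.inl ⟨hr, hrσ⟩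
          have h1 := hadj ρ hρ r hrR hρr
          have h2' : B (e ρ) r ≠ 0 := by
            rw [heρ, map_add B, map_smul B, LinearMap.add_apply, LinearMap.smul_apply, hB r, smul_eq_mul, mul_zero,
              add_zero]
            exact hρr
          exact h1.trans (hadj (e ρ) heρR r hrR h2').symm
      · rw [heρ, hB0 ρ r (hRfix ρ hρ) hrσ, mul_zero, zero_smul, add_zero]
    · have hf : δ + σ δ ∈ R := Or.inr ⟨δ, hδ, rfl⟩
      have hσδδ : B (σ δ) δ = 0 := by rw [← hB.neg_eq, hDσ0 δ hδ, neg_zero]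
      have heρ : e ρ = ρ + (c * B ρ δ) • (δ + σ δ) := by
        rw [← LinearEquiv.coe_coe, hec, Module.End.mul_apply, oneParamTransvection_apply, oneParamTransvection_apply,
          map_add B, map_smul B, LinearMap.add_apply, LinearMap.smul_apply, hσδδ, smul_eq_mul, mul_zero, add_zero,
          hBσ ρ δ (hRfix ρ hρ), smul_add]
        abel
      by_cases hρδ : B ρ δ = 0
      · rw [heρ, hρδ, mul_zero, zero_smul, add_zero]
      · have hρf : B ρ (δ + σ δ) ≠ 0 := by
          rw [(B ρ).map_add, hBσ ρ δ (hRfix ρ hρ), ← two_mul]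
          exact mul_ne_zero h2 hρδ
        have h1 := hadj ρ hρ _ hf hρf
        have h2' : B (e ρ) (δ + σ δ) ≠ 0 := by
          rw [heρ, map_add B, map_smul B, LinearMap.add_apply, LinearMap.smul_apply, hB (δ + σ δ), smul_eq_mul,
            mul_zero, add_zero]
          exact hρf
        exact h1.trans (hadj (e ρ) heρR _ hf h2').symm
  have hΓside : ∀ g ∈ Γ, ∀ ρ ∈ R, (ρ ∈ A ↔ g ρ ∈ A) := by
    intro g hg
    rw [hΓE] at hg
    refine Subgroup.closure_induction (p := fun g _ => ∀ ρ ∈ R, (ρ ∈ A ↔ g ρ ∈ A)) (fun e he => hgen e he)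
      (fun ρ _ => by rw [LinearEquiv.coe_one, id_eq]) (fun x y hx hy ihx ihy ρ hρ => ?_) (fun x hx ih ρ hρ => ?_) hg
    · have hyΓ : y ∈ Γ := by rw [hΓE]; exact hy
      rw [LinearEquiv.mul_apply]
      exact (ihy ρ hρ).trans (ihx (y ρ) (hRst y hyΓ ρ hρ))
    · have hxΓ : x⁻¹ ∈ Γ := by rw [hΓE]; exact Subgroup.inv_mem _ hx
      have h := ih (x⁻¹ ρ) (hRst _ hxΓ ρ hρ)
      rw [← LinearEquiv.mul_apply, mul_inv_cancel, LinearEquiv.coe_one, id_eq] at h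
      exact h.symm
  -- `ρ` and `−ρ` lie on the same side: a common neighbour exists
  have hnbr : ∀ ρ ∈ R, ∃ x ∈ R, B ρ x ≠ 0 := by
    intro ρ hρ
    by_contra h0
    push Not at h0
    apply hR0 ρ hρ
    refine hBn.1 ρ fun v => ?_   -- SeparatingLeft: (∀ v, B ρ v = 0) → ρ = 0
    -- decompose `v` along `V₊ ⊕ V₋`: `B ρ v = B ρ (halfProj σ v)` and `halfProj σ v ∈ span R`
    have hv : B ρ v = B ρ ((2 : K)⁻¹ • (v + σ v)) := by
      have hanti : B ρ (v - σ v) = 0 := by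
        refine hB0 ρ (v - σ v) (hRfix ρ hρ) ?_
        rw [map_sub, hσσ, neg_sub]
      have : v = (2 : K)⁻¹ • (v + σ v) + (2 : K)⁻¹ • (v - σ v) := by
        rw [← smul_add]
        have : v + σ v + (v - σ v) = (2 : K) • v := by rw [two_smul]; abel
        rw [this, smul_smul, inv_mul_cancel₀ h2, one_smul]
      conv_lhs => rw [this]
      rw [map_add, map_smul, map_smul, hanti, smul_zero, add_zero]
    have hmem : (2 : K)⁻¹ • (v + σ v) ∈ Submodule.span K R := by
      rw [hspan, Module.End.mem_eigenspace_iff, one_smul, map_smul, map_add, hσσ, add_comm]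
    rw [hv]
    refine Submodule.span_induction (p := fun w _ => B ρ w = 0) (fun x hx => h0 x hx) (map_zero _)
      (fun x y _ _ hx hy => by rw [map_add, hx, hy, add_zero]) (fun a x _ hx => by rw [map_smul, hx, smul_zero]) hmem
  have hnegside : ∀ ρ ∈ R, -ρ ∈ R → (ρ ∈ A ↔ -ρ ∈ A) := by
    intro ρ hρ hnρ
    obtain ⟨x, hx, hρx⟩ := hnbr ρ hρ
    have h1 := hadj ρ hρ x hx hρx
    have h2' : B (-ρ) x ≠ 0 := by rw [map_neg, LinearMap.neg_apply, neg_ne_zero]; exact hρx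
    exact h1.trans (hadj (-ρ) hnρ x hx h2').symm
  -- all of `R` is on the side of `f₀ = δ₀ + σδ₀`
  obtain ⟨δ₀, hδ₀⟩ := hDne
  have hf₀ : δ₀ + σ δ₀ ∈ R := Or.inr ⟨δ₀, hδ₀, rfl⟩
  have hpair : ∀ δ ∈ D, (δ + σ δ ∈ A ↔ δ₀ + σ δ₀ ∈ A) := by
    intro δ hδ
    obtain ⟨g, hg, h⟩ := htransD δ₀ hδ₀ δ hδ
    have hside := hΓside g hg _ hf₀
    have hgfR : g (δ₀ + σ δ₀) ∈ R := hRst g hg _ hf₀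
    have hf : δ + σ δ ∈ R := Or.inr ⟨δ, hδ, rfl⟩
    have hsign : g (δ₀ + σ δ₀) = δ + σ δ ∨ g (δ₀ + σ δ₀) = -(δ + σ δ) := by
      rw [map_add, hΓσ g hg]
      rcases h with h | h | h | h <;> rw [h]
      · exact Or.inl rfl
      · right; rw [map_neg, neg_add]
      · left; rw [hσσ, add_comm]
      · right; rw [map_neg, hσσ, neg_add_eq_sub, ← neg_add', add_comm]
    rcases hsign with hs | hs
    · rw [hs] at hside; exact hside.symm
    · rw [hs] at hside hgfR
      exact (hnegside _ hf hgfR).trans hside.symm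
  have hall : ∀ ρ ∈ R, (ρ ∈ A ↔ δ₀ + σ δ₀ ∈ A) := by
    rintro ρ (⟨hρT, hρσ⟩ | ⟨δ, hδ, rfl⟩)
    · obtain ⟨δ, hδ, hrδ⟩ := hlink ρ hρT hρσ
      have hf : δ + σ δ ∈ R := Or.inr ⟨δ, hδ, rfl⟩
      have hρf : B ρ (δ + σ δ) ≠ 0 := by
        rw [map_add, hBσ ρ δ hρσ, ← two_mul]
        exact mul_ne_zero h2 hrδ
      exact (hadj ρ (Or.inl ⟨hρT, hρσ⟩) _ hf hρf).trans (hpair δ hδ)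
    · exact hpair δ hδ
  -- contradiction: either `A = R` or `A = ∅`
  obtain ⟨a, haA⟩ := hAne
  have hf₀A : δ₀ + σ δ₀ ∈ A := (hall a (hAR haA)).1 haA
  apply hAR'
  exact Set.Subset.antisymm hAR fun ρ hρ => (hall ρ hρ).2 hf₀A

/-- **The `−` side from links only**: the same statement for `R₋ = {r ∈ T | σr = −r} ∪ {δ − σδ | δ ∈ D}` (apply
`orthogonallyConnected_of_links` to `−σ`). [cite: Deligne1980, §4.4 (4.4.4^α) p. 228] -/
theorem orthogonallyConnected_of_links_neg (hB : B.IsAlt) (hBn : B.Nondegenerate)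
    (h2 : (2 : K) ≠ 0) {σ : V →ₗ[K] V} (hσ : σ ^ 2 = 1) (hσB : ∀ x y, B (σ x) (σ y) = B x y)
    {Γ : Subgroup (V ≃ₗ[K] V)} {E : Set (V ≃ₗ[K] V)} (hΓE : Γ = Subgroup.closure E)
    (hΓσ : ∀ g ∈ Γ, ∀ x, g (σ x) = σ (g x)) {T D : Set V}
    (hE : ∀ e ∈ E, (∃ r ∈ T, ∃ c : K, (e : V →ₗ[K] V) = oneParamTransvection B r c) ∨
      (∃ δ ∈ D, ∃ c : K, (e : V →ₗ[K] V) = oneParamTransvection B δ c * oneParamTransvection B (σ δ) c))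
    (hTσ : ∀ r ∈ T, σ r = r ∨ σ r = -r) (hTst : ∀ g ∈ Γ, ∀ r ∈ T, g r ∈ T)
    (hT0 : ∀ r ∈ T, σ r = -r → r ≠ 0)
    (hDσ0 : ∀ δ ∈ D, B δ (σ δ) = 0) (hDst : ∀ g ∈ Γ, ∀ δ ∈ D, g δ ∈ D) (hD0 : ∀ δ ∈ D, δ - σ δ ≠ 0)
    (hDne : D.Nonempty)
    (htransD : ∀ δ ∈ D, ∀ δ' ∈ D, ∃ g ∈ Γ, g δ = δ' ∨ g δ = -δ' ∨ g δ = σ δ' ∨ g δ = -(σ δ'))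
    (hlink : ∀ r ∈ T, σ r = -r → ∃ δ ∈ D, B r δ ≠ 0)
    (hspan : Submodule.span K ({r ∈ T | σ r = -r} ∪ (fun δ => δ - σ δ) '' D) = Module.End.eigenspace σ (-1)) :
    ∀ A ⊆ {r ∈ T | σ r = -r} ∪ (fun δ => δ - σ δ) '' D, A.Nonempty →
      A ≠ {r ∈ T | σ r = -r} ∪ (fun δ => δ - σ δ) '' D →
      ∃ r ∈ A, ∃ ρ ∈ {r ∈ T | σ r = -r} ∪ (fun δ => δ - σ δ) '' D, ρ ∉ A ∧ B r ρ ≠ 0 := by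
  have hσ' : (-σ) ^ 2 = 1 := neg_sq_eq_one hσ
  have hσB' : ∀ x y, B ((-σ) x) ((-σ) y) = B x y := fun x y => by
    simp only [LinearMap.neg_apply, map_neg, neg_neg, hσB]
  have hsetT : {r ∈ T | (-σ) r = r} = {r ∈ T | σ r = -r} := by
    ext r
    simp only [Set.mem_setOf_eq, LinearMap.neg_apply, neg_eq_iff_eq_neg]
  have hsetD : (fun δ => δ + (-σ) δ) '' D = (fun δ => δ - σ δ) '' D := by
    refine Set.image_congr fun δ _ => ?_
    rw [LinearMap.neg_apply, sub_eq_add_neg]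
  have hΓσ' : ∀ g ∈ Γ, ∀ x, g ((-σ) x) = (-σ) (g x) := fun g hg => comm_neg (hΓσ g hg)
  have hE' : ∀ e ∈ E, (∃ r ∈ T, ∃ c : K, (e : V →ₗ[K] V) = oneParamTransvection B r c) ∨
      (∃ δ ∈ D, ∃ c : K, (e : V →ₗ[K] V) =
        oneParamTransvection B δ c * oneParamTransvection B ((-σ) δ) c) := by
    intro e he
    rcases hE e he with h1 | ⟨δ, hδ, c, hec⟩
    · exact Or.inl h1
    · refine Or.inr ⟨δ, hδ, c, ?_⟩
      rw [hec, LinearMap.neg_apply, ← neg_one_smul K (σ δ), oneParamTransvection_smul, mul_assoc, neg_one_mul,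
        neg_neg, mul_one]
  have hTσ' : ∀ r ∈ T, (-σ) r = r ∨ (-σ) r = -r := by
    intro r hr
    rcases hTσ r hr with h1 | h1
    · right; rw [LinearMap.neg_apply, h1]
    · left; rw [LinearMap.neg_apply, h1, neg_neg]
  have hT0' : ∀ r ∈ T, (-σ) r = r → r ≠ 0 := fun r hr h =>
    hT0 r hr (by rw [LinearMap.neg_apply, neg_eq_iff_eq_neg] at h; exact h)
  have hDσ0' : ∀ δ ∈ D, B δ ((-σ) δ) = 0 := fun δ hδ => by rw [LinearMap.neg_apply, map_neg, hDσ0 δ hδ, neg_zero]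
  have hD0' : ∀ δ ∈ D, δ + (-σ) δ ≠ 0 := fun δ hδ => by rw [LinearMap.neg_apply, ← sub_eq_add_neg]; exact hD0 δ hδ
  have htransD' : ∀ δ ∈ D, ∀ δ' ∈ D, ∃ g ∈ Γ, g δ = δ' ∨ g δ = -δ' ∨ g δ = (-σ) δ' ∨ g δ = -((-σ) δ') := by
    intro δ hδ δ' hδ'
    obtain ⟨g, hg, h⟩ := htransD δ hδ δ' hδ'
    refine ⟨g, hg, ?_⟩
    rcases h with h | h | h | h
    · exact Or.inl h
    · exact Or.inr (Or.inl h)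
    · exact Or.inr (Or.inr (Or.inr (by rw [LinearMap.neg_apply, neg_neg]; exact h)))
    · exact Or.inr (Or.inr (Or.inl (by rw [LinearMap.neg_apply]; exact h)))
  have hlink' : ∀ r ∈ T, (-σ) r = r → ∃ δ ∈ D, B r δ ≠ 0 := fun r hr h =>
    hlink r hr (by rw [LinearMap.neg_apply, neg_eq_iff_eq_neg] at h; exact h)
  have h := orthogonallyConnected_of_links hB hBn h2 hσ' hσB' hΓE hΓσ' hE' hTσ' hTst hT0' hDσ0' hDst hD0' hDne
    htransD' hlink' (by rw [hsetT, hsetD, hspan, eigenspace_neg_one])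
  rw [hsetT, hsetD] at h
  exact h

end Literature.AlgebraicGeometry.HodgeTheory

end
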